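import Summits.CriticalPhenomena.PercolationContinuityZ3.Theses.PercNearOneGluing
import Literature.Barriers.CriticalPhenomena.SprinklingRenormalisationProofs

/-!
# `Assembly` (route PercNearOneGluing, item stmt-CriticalPhenomena-4580)

The assembly of route `PercNearOneGluing` (sub-problem `PercolationContinuityZ3`):
`KNSlabBridge → NearOneGluing → PercolationContinuityZ3`.

Proof (pure logic on two PROVED cone facts). The bridge `KNSlabBridge` applied to
`NearOneGluing` (Kozma–Nitzan Conjecture 3 over finite weighted graphs) yields the same-`p` slab
statement: for every `p` with `θ_{ℤ³}(p) > 0` some slab `S_k = {0 ≤ x₀ ≤ k}` (`k > 0`), rooted at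
the origin, percolates at the same `p`. The route decl writes the slab inline as
`(zdGraph 3).induce {x | 0 ≤ x 0 ∧ x 0 ≤ k}` with root `⟨0, _⟩`, which is definitionally
`slabGraph 3 k` rooted at `slabOrigin 3 k` (`HalfSpace.lean`). The tree's proved equivalence
`Literature.Barriers.CriticalPhenomena.percolationContinuity_iff_samePSlab_holds`
(`θ(p_c(ℤ³)) = 0` ⟺ the same-`p` slab statement; its `←` direction is
`percolationContinuity_of_samePSlab` fed with the proved Duminil-Copin–Sidoravicius–Tassion slab
theorem `DuminilCopinSidoraviciusTassion2016_holds`: at `p = p_c(ℤ³)` no slab percolates) then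
gives `PercolationContinuity 3 = PercolationContinuityZ3`.
-/

namespace Summit.CriticalPhenomena.PercolationContinuityZ3.Theorems

/-- **Assembly of route PercNearOneGluing** (settles `stmt-CriticalPhenomena-4580`, exact
signature): `KNSlabBridge → NearOneGluing → PercolationContinuityZ3`. If `θ(p_c) > 0` on `ℤ³`,
the bridge (fed with near-one gluing) gives a slab `S_k`, `k > 0`, percolating at `p_c(ℤ³)`,
contradicting `θ_{S_k}(p_c(ℤ³)) = 0` (Duminil-Copin–Sidoravicius–Tassion 2016, Thm. 1, proved in
the tree, via `percolationContinuity_iff_samePSlab_holds`). [folklore] -/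
theorem percNearOneGluing_assembly_proof :
    Summit.CriticalPhenomena.PercolationContinuityZ3.Theses.PercNearOneGluing.Assembly := by
  unfold Summit.CriticalPhenomena.PercolationContinuityZ3.Theses.PercNearOneGluing.Assembly
  intro hB hX
  exact Literature.Barriers.CriticalPhenomena.percolationContinuity_iff_samePSlab_holds.mpr (hB hX)

end Summit.CriticalPhenomena.PercolationContinuityZ3.Theorems
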